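import Summits.CriticalPhenomena.PercolationContinuityZ3.Theorems.PercNearOneGluingNoHeavyLowerTailSunflowerMultiPetalSingleton
import Summits.CriticalPhenomena.PercolationContinuityZ3.Theorems.PercNearOneGluingNoHeavyLowerTailSunflowerMultiPetalSpectator
import HarnessLib
import HarnessLib.Audit

/-!
# `NoHeavyLowerTail` (crux stmt-CriticalPhenomena-4575), abstract sunflower cubic, `k` petals: ★ₖ IS A THEOREM ON AT MOST FIVE POINTS (every `k`),
# and the sub-cube spectator inequality `ZKW W + Σ triK ≥ 0`

Support file (seat `prim-l12-p2` gen 32; `--supports stmt-CriticalPhenomena-4575`; companion of `…SunflowerMultiPetalSingleton` (p343107: (MZₖ) at a coordinate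
whose singleton is not a bottom set), `…SunflowerMultiPetalSpectator` (p339016: `s6K_eq_spec`, `triK`, `antipodal_gladkov`) and `…SunflowerMultiPetalRestriction`
(p340634: `ZKW`)).  Everything here is PROVED (no `sorry`, no named fact, no conjecture, no computation): the exhaustive censuses of ★ₖ on ≤ 5 points
(FINDING-g26/g27) are replaced by a proof.  Memo: run/shared/lean/prim/prim-l12/prim-l12-p2/FINDING-g32.md §4.3.

* `MSunflower.ZKW_add_nested_triK_nonneg` : on EVERY sub-cube `2^W`, `ZKW W + Σ_{(X,Y,Z) ⊢ W} triK ≥ 0` — the rainbow count is the only negative part of the sub-cube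
  functional (three decided-spectator antipodal-Gladkov sums; sub-cube version of p339016's `ZK_add_NtriK_nonneg`, no finiteness of `α` needed).
* `MSunflower.triK_blocks_eq_zero_of_card_le_five` : if `|W| ≤ 5`, `lab ∅ = 0` and every singleton of `W` is a bottom set, then NO ordered 3-partition of `W` is a rainbow
  (one block has ≤ 1 element, hence is a bottom set).
* **`MSunflower.ZKW_nonneg_of_card_le_five`** : `|W| ≤ 5 ⟹ 0 ≤ ZKW W`, by strong induction on `W`: either some `e ∈ W` has `lab {e} ≠ 0` — then (MZₖ) at `e` (p343107) reduces to
  `W ∖ e` — or all singletons are bottom and there is no rainbow.  Hence **`MSunflower.ZK_nonneg_of_card_le_five`** (`Fintype.card α ≤ 5 ⟹ 0 ≤ ZK`) and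
  **`partitionLemmaK_of_card_le_five`**: ★ₖ holds for every `k` and every ground set of at most five points.  (Six points is the first size at which a rainbow can have
  all blocks of size ≥ 2; there ★ₖ is known only by the exhaustive census of FINDING-g27.)
-/

namespace Summit.CriticalPhenomena.PercolationContinuityZ3.Theorems.SunflowerPartition

open Finset

variable {α : Type*} [DecidableEq α]

/-- Nested sums are additive in the summand (local copy, reversed orientation of `nested_add` in `…SunflowerWindowKit`). [this work] -/
private theorem nested_add_eq (W : Finset α) (f g : Finset α → Finset α → Finset α → ℤ) :
    nested W f + nested W g = nested W (fun X Y Z => f X Y Z + g X Y Z) := by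
  unfold nested
  rw [← sum_add_distrib]
  refine sum_congr rfl fun X _ => ?_
  rw [← sum_add_distrib]

/-- `triK` vanishes as soon as one label is the bottom label. [this work] -/
theorem triK_eq_zero_of_zero {k : ℕ} {x y z : Fin (k + 2)} (h : x = 0 ∨ y = 0 ∨ z = 0) : triK k x y z = 0 := by
  unfold triK
  rw [if_neg]
  intro hc
  rcases h with h | h | h
  · exact hc.2.1 h
  · exact hc.2.2.2.1 h
  · exact hc.2.2.2.2.2.1 h

namespace MSunflower

variable {k : ℕ} (F : MSunflower k α)

/-! ## The sub-cube spectator inequality -/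

/-- A decided-spectator antipodal-Gladkov sum on a sub-cube is nonnegative. [this work] -/
theorem nested_decK_kkK_nonneg₀ (W : Finset α) :
    0 ≤ nested W (fun X Y Z => decK k (F.lab X) * kkK k (F.lab Y) (F.lab Z)) := by
  unfold nested
  refine sum_nonneg fun X _ => ?_
  rw [← mul_sum]
  refine mul_nonneg (by unfold decK; split_ifs <;> norm_num) ?_
  exact F.antipodal_gladkov (W \ X)

/-- **Sub-cube spectator inequality**: `0 ≤ ZKW W + Σ_{(X,Y,Z) ⊢ W} triK (lab X) (lab Y) (lab Z)`. [this work] -/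
theorem ZKW_add_nested_triK_nonneg (W : Finset α) :
    0 ≤ F.ZKW W + nested W (fun X Y Z => triK k (F.lab X) (F.lab Y) (F.lab Z)) := by
  unfold ZKW
  rw [nested_add_eq]
  have hsplit : nested W (fun X Y Z => s6K k (F.lab X) (F.lab Y) (F.lab Z) + triK k (F.lab X) (F.lab Y) (F.lab Z))
      = nested W (fun X Y Z => decK k (F.lab X) * kkK k (F.lab Y) (F.lab Z)
          + (decK k (F.lab Y) * kkK k (F.lab X) (F.lab Z) + decK k (F.lab Z) * kkK k (F.lab X) (F.lab Y))) := by
    unfold nested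
    refine sum_congr rfl fun X _ => sum_congr rfl fun S _ => ?_
    show s6K k _ _ _ + triK k _ _ _ = _
    rw [s6K_eq_spec]; ring
  rw [hsplit, ← nested_add_eq, ← nested_add_eq]
  have h1 := F.nested_decK_kkK_nonneg₀ W
  have h2 : 0 ≤ nested W (fun X Y Z => decK k (F.lab Y) * kkK k (F.lab X) (F.lab Z)) := by
    rw [nested_swap12]; exact F.nested_decK_kkK_nonneg₀ W
  have h3 : 0 ≤ nested W (fun X Y Z => decK k (F.lab Z) * kkK k (F.lab X) (F.lab Y)) := by
    rw [nested_swap23, nested_swap12]; exact F.nested_decK_kkK_nonneg₀ W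
  linarith

/-- Hence a sub-cube without rainbow partitions has a nonnegative functional. [this work] -/
theorem ZKW_nonneg_of_nested_triK_eq_zero (W : Finset α)
    (h : nested W (fun X Y Z => triK k (F.lab X) (F.lab Y) (F.lab Z)) = 0) : 0 ≤ F.ZKW W := by
  have := F.ZKW_add_nested_triK_nonneg W
  linarith

/-! ## At most five points: a rainbow needs a non-bottom singleton -/

/-- If `|W| ≤ 5`, `lab ∅ = 0` and all singletons of `W` are bottom sets, then no ordered 3-partition `(X, S, (W∖X)∖S)` of `W` is a rainbow. [this work] -/
theorem triK_blocks_eq_zero_of_card_le_five (W : Finset α) (hW : W.card ≤ 5) (h0 : F.lab ∅ = 0) (hs : ∀ e ∈ W, F.lab {e} = 0)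
    {X S : Finset α} (hX : X ⊆ W) (hS : S ⊆ W \ X) :
    triK k (F.lab X) (F.lab S) (F.lab ((W \ X) \ S)) = 0 := by
  -- a block of cardinality ≤ 1 inside `W` is a bottom set
  have small : ∀ B : Finset α, B ⊆ W → B.card ≤ 1 → F.lab B = 0 := by
    intro B hB hc
    rcases Nat.le_one_iff_eq_zero_or_eq_one.1 hc with hc0 | hc1
    · rw [card_eq_zero.1 hc0]; exact h0
    · obtain ⟨e, rfl⟩ := card_eq_one.1 hc1
      exact hs e (hB (mem_singleton_self e))
  have hT : (W \ X) \ S ⊆ W := sdiff_subset.trans sdiff_subset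
  have hSW : S ⊆ W := hS.trans sdiff_subset
  -- cardinalities: |X| + |S| + |(W∖X)∖S| = |W| ≤ 5, so one block has ≤ 1 element
  have hc1 : (W \ X).card = W.card - X.card := card_sdiff_of_subset hX
  have hc2 : ((W \ X) \ S).card = (W \ X).card - S.card := card_sdiff_of_subset hS
  have hXle : X.card ≤ W.card := card_le_card hX
  have hSle : S.card ≤ (W \ X).card := card_le_card hS
  by_cases hx : X.card ≤ 1
  · exact triK_eq_zero_of_zero (Or.inl (small X hX hx))
  by_cases hs1 : S.card ≤ 1
  · exact triK_eq_zero_of_zero (Or.inr (Or.inl (small S hSW hs1)))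
  · apply triK_eq_zero_of_zero; right; right
    apply small _ hT
    omega

/-! ## ★ₖ on at most five points -/

/-- **★ₖ ON AT MOST FIVE POINTS (sub-cube form)**: `|W| ≤ 5 ⟹ 0 ≤ ZKW W`. [this work] -/
theorem ZKW_nonneg_of_card_le_five (W : Finset α) (hW : W.card ≤ 5) : 0 ≤ F.ZKW W := by
  induction W using Finset.strongInduction with
  | H W ih =>
    by_cases hex : ∃ e ∈ W, F.lab {e} ≠ 0
    · obtain ⟨e, heW, hne⟩ := hex
      have h1 := F.ZKW_le_ZKW_insert_of_lab_singleton_ne_zero (W.erase e) e (notMem_erase e W) hne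
      rw [insert_erase heW] at h1
      have h2 : 0 ≤ F.ZKW (W.erase e) := ih (W.erase e) (erase_ssubset heW) (le_trans (card_le_card (erase_subset e W)) hW)
      exact le_trans h2 h1
    · push Not at hex
      rcases W.eq_empty_or_nonempty with hWe | hWne
      · rw [hWe, ZKW_empty]
      · obtain ⟨e, heW⟩ := hWne
        have h0 : F.lab ∅ = 0 := by
          rcases F.lab_mono (empty_subset {e}) with h | h | h
          · rw [h]; exact hex e heW
          · exact h
          · exfalso
            have h' := hex e heW
            rw [h] at h'
            have := congrArg Fin.val h'
            simp at this
        refine F.ZKW_nonneg_of_nested_triK_eq_zero W ?_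
        unfold nested
        refine sum_eq_zero fun X hX => sum_eq_zero fun S hS => ?_
        exact F.triK_blocks_eq_zero_of_card_le_five W hW h0 hex (mem_powerset.1 hX) (mem_powerset.1 hS)

/-- **★ₖ ON AT MOST FIVE POINTS**: `Fintype.card α ≤ 5 ⟹ 0 ≤ ZK`, for every `k` and every monotone map `2^α → M_k`. [this work] -/
theorem ZK_nonneg_of_card_le_five [Fintype α] (h : Fintype.card α ≤ 5) : 0 ≤ F.ZK := by
  rw [← F.ZKW_univ]
  exact F.ZKW_nonneg_of_card_le_five univ (by rw [card_univ]; exact h)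

end MSunflower

/-- **`PartitionLemmaK` restricted to ground sets of at most five points is a theorem** (no census, no computation). [this work] -/
theorem partitionLemmaK_of_card_le_five (k : ℕ) (α : Type) [Fintype α] [DecidableEq α] (h : Fintype.card α ≤ 5) (F : MSunflower k α) :
    0 ≤ F.ZK :=
  F.ZK_nonneg_of_card_le_five h

end Summit.CriticalPhenomena.PercolationContinuityZ3.Theorems.SunflowerPartition
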